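import Summits.CriticalPhenomena.PercolationContinuityZ3.Theorems.FK.InfiniteVolumeBoxLaws
import Summits.CriticalPhenomena.PercolationContinuityZ3.Theorems.FK.BoxLimitComparison
import Summits.CriticalPhenomena.PercolationContinuityZ3.Theorems.FK.Transplant.FreeBoundaryHypotheses
import Summits.CriticalPhenomena.PercolationContinuityZ3.Theorems.FK.Transplant.KNFreePinning
import Summits.CriticalPhenomena.PercolationContinuityZ3.Theorems.FK.Transplant.KNFreePinningDomainMarkov
import Summits.CriticalPhenomena.PercolationContinuityZ3.Theorems.FK.Transplant.KNFreePinningEmbedding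
import Literature.Probability.LatticeModels.RandomClusterEdgeWeightsHomogeneous
import Literature.Probability.LatticeModels.ThermodynamicLimit
import Literature.Probability.Percolation.SharpnessDCTProofs
import Literature.Probability.Percolation.HistorySiteRenormalization
import HarnessLib

/-!
# FK-continuity transplant, FO-11 (3c/4): the DLR step of C2 — domination of DECREASING local events under
# the free infinite-volume random-cluster measure by the PINNED finite-volume law (history's open edges wired)

Cell `fk-continuity` (bschramm), row FO-11 (C2; lead ruling L8: "the FK twin of HistorySiteRenormalization —
independence at AdaptiveProbing:258 replaced by worst-case-outside uniformity — is FO-11's"); support file for the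
FK-continuity transplant (`--supports stmt-CriticalPhenomena-4575`); builds on p205010 (kernel theorem, internal
audit signed; external expert review pending).  No named facts, no sorries, standard axioms.

## The statement (`IsBoxLimit.real_inter_le_fkLaw_mul`)

Let `P` be the FREE infinite-volume random-cluster measure `φ⁰_{p,q}` on `ℤ^d` in the cell's sense
(`IsBoxLimit d false p q P`: local limit of the free box measures, rows FO-06b), `q ≥ 1`.  Fix a finite region
`R ⊆ ℤ^d`, a finite set `F` of lattice edges ("fresh"), a finite set `I` of pairs ("pinned open", the history's open
edges) and edge parameters `W : Sym2 (Site d) → [0,1]` supported on the pairs of `R` with `W ≤ p` on `F` and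
`W e ≠ 0 ⇒ e ∈ I` off `F` — Kozma–Nitzan's MINIMAL weighting of the region examined after a history (cell row
FO-05, `FKScheme.minW`: density `p` on the fresh lattice edges, the revealed-open edges pinned open, everything
else deleted).  Then for every DECREASING event `D` determined by `F` and every event `H` determined by a finite
set of pairs disjoint from `F` on which all edges of `I` are open,

  `P(D ∩ H) ≤ (fkLaw R W q)(D) · P(H)`,

i.e. conditionally on the past `H` the failure event `D` is at most as likely as under the pinned law
`fkLaw R W q` (the cell's `fkLaw`, row FT-01: `rcMeasureW` on `R` with weights `W`, read on `ℤ^d`).  This is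
Grimmett 2006, Lemma (4.13) (domain Markov: in a box `Λ_n ⊇ R`, given the full configuration `ξ` off `F` the law on
`F` is the random-cluster measure with the weights `condWeights`: `p` on `F`, `1` on `ξ`, `0` elsewhere — the tree's
`rcMeasureW_real_inter_eq_sum_pattern`) with Lemma (4.14)(b)/(3.22) (comparison in the weights, edge by edge:
`ξ ⊇ I` on `H`, so `condWeights ≥ W` pointwise and the decreasing `D` is MORE likely under `W` — the tree's
`rcMeasureW_real_anti_weights_of_isLowerSet`), the identification of the `W`-law inside `Λ_n` with `fkLaw R W q`
(`rcMeasureW_real_preimage_image_sym2Map`, weights vanishing off `R`), and the passage `Λ_n ↑ ℤ^d` along the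
defining local limit (the cell's `IsBoxLimit.tendsto_real_of_determinedBy`, file `BoxLimitComparison.lean`).  It is the input `dom` of `SameP.LawLawful` (file `SamePContinuationLaws.lean`) for the cell's
crux C1 in its Level-C form, and — unlike the `FKGibbs` sandwich of `InfiniteVolumeGibbs.lean`, which conditions only
on information outside `E_R` — it credits pins INSIDE the region.

## References

* G. Grimmett, *The Random-Cluster Model*, Springer 2006: Thm (3.7) p. 39, Thm (3.21)/(3.22) p. 48, Lemma (4.13)
  p. 71, Lemma (4.14)(b) p. 72, Thm (4.19)(a) p. 77. [Grimmett2006]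
* G. Kozma, S. Nitzan, arXiv:2401.12397 (2024), §4 pp. 20–22, 25 (conditioning on the revealed pattern).
  [KozmaNitzan2024]
-/

noncomputable section

namespace Summit.CriticalPhenomena.PercolationContinuityZ3.Theorems.FK

open MeasureTheory Filter Literature.Probability.Percolation Literature.Probability.LatticeModels
open scoped ENNReal Classical Topology

namespace SameP

variable {d : ℕ}

/-! ### Pull-backs along `liftEdges` -/

/-- The pairs of a piece `Λ` lying over a set `K` of pairs of `ℤ^d`. [folklore] -/
def overPairs (Λ : Finset (Site d)) (K : Set (Sym2 (Site d))) : Set (Sym2 ↥Λ) :=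
  {e | Sym2.map Subtype.val e ∈ K}

/-- Membership in `overPairs`. [folklore] -/
@[simp] theorem mem_overPairs {Λ : Finset (Site d)} {K : Set (Sym2 (Site d))} {e : Sym2 ↥Λ} :
    e ∈ overPairs Λ K ↔ Sym2.map Subtype.val e ∈ K := Iff.rfl

/-- `liftEdges` is compatible with the (injective) `Sym2.map val`: `Sym2.map val e ∈ liftEdges Λ ω ↔ e ∈ ω`.
[folklore] -/
theorem map_mem_liftEdges_iff {Λ : Finset (Site d)} {ω : BondConfig ↥Λ} {e : Sym2 ↥Λ} :
    Sym2.map Subtype.val e ∈ liftEdges Λ ω ↔ e ∈ ω := by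
  rw [mem_liftEdges_iff]
  constructor
  · rintro ⟨e', he', hee'⟩
    rwa [← Sym2.map.injective Subtype.val_injective hee']
  · exact fun h => ⟨e, h, rfl⟩

/-- An event determined by `K` pulls back along `liftEdges Λ` to an event determined by the pairs over `K`.
[folklore] -/
theorem determinedBy_preimage_liftEdges {Λ : Finset (Site d)} {A : Set (BondConfig (Site d))}
    {K : Set (Sym2 (Site d))} (hA : DeterminedBy A K) : DeterminedBy (liftEdges Λ ⁻¹' A) (overPairs Λ K) := by
  rw [determinedBy_iff] at hA ⊢
  intro ω ω' h
  simp only [Set.mem_preimage]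
  refine hA _ _ (Set.ext fun e => ?_)
  simp only [Set.mem_inter_iff, mem_liftEdges_iff]
  constructor
  · rintro ⟨⟨e', he', rfl⟩, hK⟩
    have : e' ∈ ω' ∩ overPairs Λ K := by rw [← h]; exact ⟨he', hK⟩
    exact ⟨⟨e', this.1, rfl⟩, hK⟩
  · rintro ⟨⟨e', he', rfl⟩, hK⟩
    have : e' ∈ ω ∩ overPairs Λ K := by rw [h]; exact ⟨he', hK⟩
    exact ⟨⟨e', this.1, rfl⟩, hK⟩

/-! ### The inclusion of a region into a box and the identification of the pinned law -/

/-- Lifting through the box after including the region is lifting from the region (set version of the cell's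
`liftEdges_coe_map_edgeLift`). [folklore] -/
theorem liftEdges_image_map_finsetInclEmb {R Λ : Finset (Site d)} (h : R ⊆ Λ) (ω : BondConfig ↥R) :
    liftEdges Λ (Sym2.map (finsetInclEmb h) '' ω) = liftEdges R ω := by
  ext e
  simp only [mem_liftEdges_iff, Set.mem_image]
  constructor
  · rintro ⟨_, ⟨e', he', rfl⟩, rfl⟩
    refine ⟨e', he', ?_⟩
    induction e' using Sym2.ind with
    | h a c => simp [finsetInclEmb]
  · rintro ⟨e', he', rfl⟩
    refine ⟨Sym2.map (finsetInclEmb h) e', ⟨e', he', rfl⟩, ?_⟩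
    induction e' using Sym2.ind with
    | h a c => simp [finsetInclEmb]

/-- Reading the weights of `ℤ^d` on the box and then along the inclusion of the region is reading them on the
region. [folklore] -/
theorem weights_map_finsetInclEmb {R Λ : Finset (Site d)} (h : R ⊆ Λ) (W : Sym2 (Site d) → unitInterval) :
    (fun e : Sym2 ↥R => W (Sym2.map Subtype.val (Sym2.map (finsetInclEmb h) e))) =
      fun e : Sym2 ↥R => W (Sym2.map Subtype.val e) := by
  funext e
  induction e using Sym2.ind with
  | h a c => simp [finsetInclEmb]

/-- **The pinned law does not see the ambient box**: for weights `W` supported on the pairs of `R ⊆ Λ`, the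
`rcMeasureW` of the box `Λ` with weights `W` (read through `Sym2.map val`), read on `ℤ^d`, gives every measurable
event the probability `fkLaw R W q` gives it (the tree's `rcMeasureW_real_preimage_image_sym2Map`: edges of weight
`0` are almost surely closed and do not change the law of the clusters). [cite: Grimmett2006, §4.2 (4.11)–(4.13)] -/
theorem rcMeasureW_box_real_preimage_eq_fkLaw {R Λ : Finset (Site d)} (h : R ⊆ Λ)
    (W : Sym2 (Site d) → unitInterval) (hWR : ∀ e, W e ≠ 0 → ∀ x ∈ e, x ∈ R) {q : ℝ} (hq : 0 < q)
    {A : Set (BondConfig (Site d))} (hA : MeasurableSet A) :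
    (rcMeasureW (fun e : Sym2 ↥Λ => W (Sym2.map Subtype.val e)) q (∅ : Set ↥Λ)).real (liftEdges Λ ⁻¹' A) =
      (fkLaw R W q).real A := by
  have hw'0 : ∀ e : Sym2 ↥Λ, e ∉ Set.range (Sym2.map (finsetInclEmb h)) →
      (fun e : Sym2 ↥Λ => W (Sym2.map Subtype.val e)) e = 0 := by
    intro e he
    by_contra hne
    apply he
    induction e using Sym2.ind with
    | h x y =>
      have hx : x.1 ∈ R := hWR _ hne x.1 (by simp)
      have hy : y.1 ∈ R := hWR _ hne y.1 (by simp)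
      refine ⟨s(⟨x.1, hx⟩, ⟨y.1, hy⟩), ?_⟩
      simp [finsetInclEmb, finsetIncl]
  have key := rcMeasureW_real_preimage_image_sym2Map (finsetInclEmb h)
    (fun e : Sym2 ↥Λ => W (Sym2.map Subtype.val e)) hw'0 hq (∅ : Set ↥R) (liftEdges Λ ⁻¹' A)
  rw [Set.image_empty] at key
  have hset : {ω : BondConfig ↥R | Sym2.map (finsetInclEmb h) '' ω ∈ liftEdges Λ ⁻¹' A} = liftEdges R ⁻¹' A := by
    ext ω; simp only [Set.mem_setOf_eq, Set.mem_preimage, liftEdges_image_map_finsetInclEmb h ω]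
  rw [← key, weights_map_finsetInclEmb h W, hset, fkLaw, map_measureReal_apply (measurable_liftEdges R) hA]

/-! ### Finite volume: the pinned domination in a box -/

/-- **Pinned domination in a box** (Grimmett 2006, Lemma (4.13) + (4.14)(b)/(3.22), for the free box measure
`φ⁰_{Λ_n,p,q}` read on `ℤ^d`): with `R ⊆ Λ_n`, `F` (fresh lattice edges), `I` (pinned-open pairs), weights `W` as in
the module docstring, `D` decreasing determined by `F`, `H` determined by `T` disjoint from `F` with `I` open on `H`:
`φ⁰_{Λ_n}(D ∩ H) ≤ (fkLaw R W q)(D) · φ⁰_{Λ_n}(H)`. [cite: Grimmett2006, Lemma (4.13) and Lemma (4.14)(b)] -/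
theorem rcBoxLaw_real_inter_le_fkLaw_mul {p q : ℝ} (hp : p ∈ Set.Icc (0 : ℝ) 1) (hq : 1 ≤ q) {n : ℕ}
    {R : Finset (Site d)} (hR : R ⊆ box d n) (W : Sym2 (Site d) → unitInterval)
    (F I T : Finset (Sym2 (Site d))) (hF : (↑F : Set (Sym2 (Site d))) ⊆ (zdGraph d).edgeSet)
    (hWF : ∀ e ∈ F, (W e : ℝ) ≤ p) (hWI : ∀ e ∉ F, W e ≠ 0 → e ∈ I) (hWR : ∀ e, W e ≠ 0 → ∀ x ∈ e, x ∈ R)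
    {D H : Set (BondConfig (Site d))} (hD : IsLowerSet D) (hDF : DeterminedBy D ↑F)
    (hHT : DeterminedBy H ↑T) (hTF : Disjoint T F) (hHI : H ⊆ {ω | (↑I : Set (Sym2 (Site d))) ⊆ ω}) :
    (rcBoxLaw d false p q n).real (D ∩ H) ≤ (fkLaw R W q).real D * (rcBoxLaw d false p q n).real H := by
  have hq0 : 0 < q := one_pos.trans_le hq
  -- measurability of the local events involved
  have hDm : MeasurableSet D := hDF.measurableSet_of_finset
  have hHm : MeasurableSet H := hHT.measurableSet_of_finset
  have hDHm : MeasurableSet (D ∩ H) := hDm.inter hHm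
  set Λ := box d n with hΛ
  set w : Sym2 ↥Λ → unitInterval := edgeIndicatorWeights (finsetGraph (zdGraph d) Λ) ⟨p, hp⟩ with hw
  set w' : Sym2 ↥Λ → unitInterval := fun e => W (Sym2.map Subtype.val e) with hw'
  -- the free box measure is the edge-parameter measure with indicator weights
  have hbox : rcBoxMeasure d false p q n = rcMeasureW w q (∅ : Set ↥Λ) := by
    rw [rcBoxMeasure_false]
    exact rcMeasure_eq_rcMeasureW (finsetGraph (zdGraph d) Λ) ⟨p, hp⟩ hq0 ∅
  have hreal : ∀ A : Set (BondConfig (Site d)), MeasurableSet A →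
      (rcBoxLaw d false p q n).real A = (rcMeasureW w q (∅ : Set ↥Λ)).real (liftEdges Λ ⁻¹' A) := by
    intro A hA
    rw [rcBoxLaw_real_apply _ _ _ _ hA, hbox]
  -- the revealed set of the box: every pair NOT over `F`
  set S : Finset (Sym2 ↥Λ) := Finset.univ.filter fun e => Sym2.map Subtype.val e ∉ F with hS
  have hScompl : (↑S : Set (Sym2 ↥Λ))ᶜ = overPairs Λ ↑F := by
    ext e; simp [hS, overPairs]
  -- pulled-back events
  set D' := liftEdges Λ ⁻¹' D with hD'
  set H' := liftEdges Λ ⁻¹' H with hH'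
  have hD'low : IsLowerSet D' := isLowerSet_preimage_liftEdges Λ hD
  have hH'det : DeterminedBy H' (↑S : Set (Sym2 ↥Λ)) := by
    refine (determinedBy_preimage_liftEdges (Λ := Λ) hHT).mono fun e he => ?_
    rw [mem_overPairs] at he
    simp only [hS, Finset.coe_filter, Finset.mem_univ, true_and, Set.mem_setOf_eq]
    exact fun heF => Finset.disjoint_left.1 hTF he heF
  -- domain Markov: sum over the patterns on `S` realising `H'`
  haveI : ∀ ξ : Finset (Sym2 ↥Λ),
      IsProbabilityMeasure (rcMeasureW (condWeights w (↑S : Set (Sym2 ↥Λ))ᶜ ↑ξ) q (∅ : Set ↥Λ)) :=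
    fun ξ => isProbabilityMeasure_rcMeasureW _ hq0 ∅
  have hsumD := rcMeasureW_real_inter_eq_sum_pattern w hq0 (∅ : Set ↥Λ) S D' hH'det
  have hsum1 := rcMeasureW_real_inter_eq_sum_pattern w hq0 (∅ : Set ↥Λ) S Set.univ hH'det
  rw [Set.univ_inter] at hsum1
  simp only [probReal_univ, mul_one] at hsum1
  -- per pattern: the conditional weights dominate `w'`, so the decreasing `D'` is more likely under `w'`
  have hterm : ∀ ξ ∈ S.powerset.filter (fun T : Finset (Sym2 ↥Λ) => (↑T : Set (Sym2 ↥Λ)) ∈ H'),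
      (rcMeasureW (condWeights w (↑S : Set (Sym2 ↥Λ))ᶜ ↑ξ) q (∅ : Set ↥Λ)).real D' ≤
        (rcMeasureW w' q (∅ : Set ↥Λ)).real D' := by
    intro ξ hξ
    have hξH : (↑ξ : Set (Sym2 ↥Λ)) ∈ H' := (Finset.mem_filter.1 hξ).2
    have hIξ : ∀ e : Sym2 ↥Λ, Sym2.map Subtype.val e ∈ I → e ∈ ξ := by
      intro e he
      have hsub := hHI hξH
      have : Sym2.map Subtype.val e ∈ liftEdges Λ ↑ξ := hsub (Finset.mem_coe.2 he)
      exact Finset.mem_coe.1 (map_mem_liftEdges_iff.1 this)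
    refine rcMeasureW_real_anti_weights_of_isLowerSet (fun e => Subtype.coe_le_coe.1 ?_) hq ∅ hD'low
    -- `(w' e : ℝ) ≤ condWeights w Sᶜ ξ e`
    rw [hScompl]
    simp only [hw', condWeights]
    by_cases heF : e ∈ overPairs Λ ↑F
    · rw [if_pos heF]
      have heF' : Sym2.map Subtype.val e ∈ F := heF
      have hadj : e ∈ (finsetGraph (zdGraph d) Λ).edgeSet := by
        induction e using Sym2.ind with
        | h x y =>
          rw [SimpleGraph.mem_edgeSet, finsetGraph_adj_iff]
          exact (SimpleGraph.mem_edgeSet _).1 (hF (by simpa using heF'))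
      have hwe : w e = ⟨p, hp⟩ := by simp [hw, edgeIndicatorWeights, hadj]
      rw [hwe]
      exact hWF _ heF'
    · rw [if_neg heF]
      by_cases hW0 : W (Sym2.map Subtype.val e) = 0
      · rw [hW0]
        split_ifs
        · simp
        · simp
      · have heI : e ∈ (↑ξ : Set (Sym2 ↥Λ)) := Finset.mem_coe.2 (hIξ e (hWI _ heF hW0))
        rw [if_pos heI]
        simpa using (W (Sym2.map Subtype.val e)).2.2
  -- assemble
  calc (rcBoxLaw d false p q n).real (D ∩ H)
      = (rcMeasureW w q (∅ : Set ↥Λ)).real (D' ∩ H') := by rw [hreal _ hDHm, Set.preimage_inter]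
    _ = ∑ ξ ∈ S.powerset.filter (fun T : Finset (Sym2 ↥Λ) => (↑T : Set (Sym2 ↥Λ)) ∈ H'),
          (rcMeasureW w q (∅ : Set ↥Λ)).real {ω | ω ∩ ↑S = ↑ξ} *
            (rcMeasureW (condWeights w (↑S : Set (Sym2 ↥Λ))ᶜ ↑ξ) q (∅ : Set ↥Λ)).real D' := hsumD
    _ ≤ ∑ ξ ∈ S.powerset.filter (fun T : Finset (Sym2 ↥Λ) => (↑T : Set (Sym2 ↥Λ)) ∈ H'),
          (rcMeasureW w q (∅ : Set ↥Λ)).real {ω | ω ∩ ↑S = ↑ξ} * (rcMeasureW w' q (∅ : Set ↥Λ)).real D' :=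
        Finset.sum_le_sum fun ξ hξ => mul_le_mul_of_nonneg_left (hterm ξ hξ) measureReal_nonneg
    _ = (rcMeasureW w' q (∅ : Set ↥Λ)).real D' * (rcMeasureW w q (∅ : Set ↥Λ)).real H' := by
        rw [← Finset.sum_mul, mul_comm, ← hsum1]
    _ = (fkLaw R W q).real D * (rcBoxLaw d false p q n).real H := by
        rw [hD', rcMeasureW_box_real_preimage_eq_fkLaw hR W hWR hq0 hDm, hreal _ hHm]

end SameP

/-! ### Infinite volume: the free box limit -/

variable {d : ℕ}

/-- **The DLR step of the continuation principle: pinned domination under the free infinite-volume measure.**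
For the free box limit `P = φ⁰_{p,q}` (`IsBoxLimit d false p q P`, `q ≥ 1`), a region `R`, fresh lattice edges `F`,
pinned-open pairs `I`, weights `W` supported on the pairs of `R` with `W ≤ p` on `F` and `W ≠ 0 ⇒ ∈ I` off `F`, a
DECREASING event `D` determined by `F`, and an event `H` determined by a finite `T` disjoint from `F` on which `I` is
open:  `P(D ∩ H) ≤ (fkLaw R W q)(D) · P(H)`  (finite volume `rcBoxLaw_real_inter_le_fkLaw_mul`, then `Λ_n ↑ ℤ^d`).
This is the hypothesis `dom` of `SameP.LawLawful` for the cell's pinned per-direction laws (C1, Level C).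
[cite: Grimmett2006, Lemma (4.13), Lemma (4.14)(b) and Thm. (4.19)(a)] -/
theorem IsBoxLimit.real_inter_le_fkLaw_mul {p q : ℝ} {P : Measure (BondConfig (Site d))}
    (hP : IsBoxLimit d false p q P) (hp : p ∈ Set.Icc (0 : ℝ) 1) (hq : 1 ≤ q)
    (R : Finset (Site d)) (W : Sym2 (Site d) → unitInterval)
    (F I T : Finset (Sym2 (Site d))) (hF : (↑F : Set (Sym2 (Site d))) ⊆ (zdGraph d).edgeSet)
    (hWF : ∀ e ∈ F, (W e : ℝ) ≤ p) (hWI : ∀ e ∉ F, W e ≠ 0 → e ∈ I) (hWR : ∀ e, W e ≠ 0 → ∀ x ∈ e, x ∈ R)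
    {D H : Set (BondConfig (Site d))} (hD : IsLowerSet D) (hDF : DeterminedBy D ↑F)
    (hHT : DeterminedBy H ↑T) (hTF : Disjoint T F) (hHI : H ⊆ {ω | (↑I : Set (Sym2 (Site d))) ⊆ ω}) :
    P.real (D ∩ H) ≤ (fkLaw R W q).real D * P.real H := by
  -- both sides are limits of box-law probabilities of local events
  have hDH : DeterminedBy (D ∩ H) ↑(F ∪ T) := by
    rw [Finset.coe_union]
    exact (hDF.mono Set.subset_union_left).inter (hHT.mono Set.subset_union_right)
  have h1 := hP.tendsto_real_of_determinedBy hDH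
  have h2 := (hP.tendsto_real_of_determinedBy hHT).const_mul ((fkLaw R W q).real D)
  -- eventually `R ⊆ Λ_n`, where the finite-volume inequality holds
  obtain ⟨N, hN⟩ := DCT16.exists_subset_box R
  refine le_of_tendsto_of_tendsto h1 h2 (Filter.eventually_atTop.2 ⟨N, fun n hn => ?_⟩)
  exact SameP.rcBoxLaw_real_inter_le_fkLaw_mul hp hq (hN.trans (box_mono d hn)) W F I T hF hWF hWI hWR hD hDF
    hHT hTF hHI

/-! ### Glue for the cell's crux C1 (Level C): the conditional failure bound of a history-driven scheme -/

/-- Along a history of an adaptive explorer every recorded observation consists of open edges: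
`hist n ω = h ⇒ opens h ⊆ ω`. [folklore] -/
theorem opens_subset_of_hist_eq {V : Type*} (E : AExplorer V) {n : ℕ} {h : ProbeHistory V} {ω : BondConfig V}
    (hh : E.hist n ω = h) : (↑(KozmaNitzan.opens h) : Set (Sym2 V)) ⊆ ω := by
  induction n generalizing h with
  | zero => subst hh; simp [AExplorer.hist_zero]
  | succ n ih =>
    subst hh
    rw [AExplorer.hist_succ]
    cases hD : E.next (E.hist n ω) with
    | none =>
      rw [E.step_of_none hD, KozmaNitzan.opens_cons_none]
      exact ih rfl
    | some P =>
      rw [E.step_of_some hD, KozmaNitzan.opens_cons_some, Finset.coe_union]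
      refine Set.union_subset (fun e he => ?_) (ih rfl)
      simp only [Finset.mem_coe, AProbe.record, AProbe.read, obs, Finset.mem_filter] at he
      exact he.2

/-- **The hypothesis `dom` of `SameP.LawLawful` for pinned per-direction laws** (cell crux C1, Level C): if the
failure event of the probe after `h` is covered by finitely many DECREASING "bad" events `bad i`, each determined by
a fresh set `F i` of lattice edges disjoint from `U₀ ∪ supp h`, and the weights `W i` of the region `R i` are at most
`p` on `F i`, pin only edges of the recorded pattern `U₀ ∪ opens h` off `F i`, and vanish off `R i`, then under the
free box limit `P = φ⁰_{p,q}` (`q ≥ 1`):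
`P(A₀ ∩ {hist n = h} ∩ {¬succ}) ≤ (∑_i (fkLaw (R i) (W i) q)(bad i)) · P(A₀ ∩ {hist n = h})`.
[cite: KozmaNitzan2024, §4 p. 25 (clause (4)) and pp. 20–22; Grimmett2006, Lemma (4.13)/(4.14)(b)] -/
theorem IsBoxLimit.real_inter_notSucc_le_sum_fkLaw_mul {p q : ℝ} {P : Measure (BondConfig (Site d))}
    (hP : IsBoxLimit d false p q P) (hp : p ∈ Set.Icc (0 : ℝ) 1) (hq : 1 ≤ q)
    (S : HSiteScheme (Site d)) (n : ℕ) (h : ProbeHistory (Site d)) (Pr : AProbe (Site d)) (e : Site 2 × MDir)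
    {ι : Type*} (dirs : Finset ι) (R : ι → Finset (Site d)) (W : ι → Sym2 (Site d) → unitInterval)
    (F : ι → Finset (Sym2 (Site d))) (bad : ι → Set (BondConfig (Site d)))
    (hcover : {ω | ¬S.succ h e (Pr.read ω)} ⊆ ⋃ i ∈ dirs, bad i)
    (hF : ∀ i ∈ dirs, (↑(F i) : Set (Sym2 (Site d))) ⊆ (zdGraph d).edgeSet)
    (hWF : ∀ i ∈ dirs, ∀ e' ∈ F i, (W i e' : ℝ) ≤ p)
    (hWI : ∀ i ∈ dirs, ∀ e' ∉ F i, W i e' ≠ 0 → e' ∈ S.U₀ ∪ KozmaNitzan.opens h)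
    (hWR : ∀ i ∈ dirs, ∀ e', W i e' ≠ 0 → ∀ x ∈ e', x ∈ R i)
    (hbad : ∀ i ∈ dirs, IsLowerSet (bad i)) (hbadF : ∀ i ∈ dirs, DeterminedBy (bad i) ↑(F i))
    (hfresh : ∀ i ∈ dirs, Disjoint (S.U₀ ∪ ProbeHistory.supp h) (F i)) :
    P.real (S.initEvent ∩ {ω | S.E.hist n ω = h} ∩ {ω | ¬S.succ h e (Pr.read ω)}) ≤
      (∑ i ∈ dirs, (fkLaw (R i) (W i) q).real (bad i)) * P.real (S.initEvent ∩ {ω | S.E.hist n ω = h}) := by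
  haveI := hP.isProbabilityMeasure
  set H : Set (BondConfig (Site d)) := S.initEvent ∩ {ω | S.E.hist n ω = h} with hH
  have hHT : DeterminedBy H ↑(S.U₀ ∪ ProbeHistory.supp h) := by
    rw [Finset.coe_union]
    exact (HSiteScheme.determinedBy_initEvent.mono Set.subset_union_left).inter
      ((S.E.determinedBy_hist n h).mono Set.subset_union_right)
  have hHI : H ⊆ {ω | (↑(S.U₀ ∪ KozmaNitzan.opens h) : Set (Sym2 (Site d))) ⊆ ω} := by
    rintro ω ⟨hA, hh⟩
    rw [Set.mem_setOf_eq, Finset.coe_union]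
    exact Set.union_subset hA (opens_subset_of_hist_eq S.E hh)
  calc P.real (H ∩ {ω | ¬S.succ h e (Pr.read ω)})
      ≤ P.real (⋃ i ∈ dirs, bad i ∩ H) := by
        refine measureReal_mono (fun ω hω => ?_) (measure_ne_top _ _)
        obtain ⟨hωH, hωf⟩ := hω
        have := hcover hωf
        simp only [Set.mem_iUnion] at this ⊢
        obtain ⟨i, hi, hωi⟩ := this
        exact ⟨i, hi, hωi, hωH⟩
    _ ≤ ∑ i ∈ dirs, P.real (bad i ∩ H) := measureReal_biUnion_finset_le _ _
    _ ≤ ∑ i ∈ dirs, (fkLaw (R i) (W i) q).real (bad i) * P.real H :=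
        Finset.sum_le_sum fun i hi => hP.real_inter_le_fkLaw_mul hp hq (R i) (W i) (F i)
          (S.U₀ ∪ KozmaNitzan.opens h) (S.U₀ ∪ ProbeHistory.supp h) (hF i hi) (hWF i hi) (hWI i hi) (hWR i hi)
          (hbad i hi) (hbadF i hi) hHT (hfresh i hi) hHI
    _ = (∑ i ∈ dirs, (fkLaw (R i) (W i) q).real (bad i)) * P.real H := by rw [Finset.sum_mul]

end Summit.CriticalPhenomena.PercolationContinuityZ3.Theorems.FK

end
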